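import Summits.QuantumFields.YangMills.Theorems.UnitScaleTiltProp8ChartDoubleBarDefs
import HarnessLib

/-!
# Route `UnitScaleTilt`, crux K1 child «MinimiserStabilityRegPr» (stmt-QuantumFields-19200), skeleton v10 stub EX, route (α) — **DEFINITIONS FILE (generic part): THE
# SYMMETRIC, CENTRE-ANCHORED, COVARIANT FRAMES OF RECORD** (OWNER RULING g26-№12 (T-sym-frames), 2026-08-28 07:35Z): the `U₀ ≠ 1` twins of ✓`Prop8ChartDoubleBar.vframeU` ∕
# `dbarAvgU` ∕ `dbarIterU` over the route's OWN `Idx P` stair family from the block centres `emb y` ([Balaban1985Averaging] (82) frames of the twisted transporters (58), (89) double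
# bar, (97) accumulation, (127)∕(150) iteration against the background tower), at ANY level `j` over ANY complete normed ℂ-algebra `𝔸` — the objects the EX (47)-twˢ bricks
# W0–W4 induct on; the T³ letters `frameTwS`∕`dbarTwS`∕`logChartTwS`∕`QTwS`∕`CmapTwS`∕`Chart47T3twS` and the sanity theorems (J1)-T³∕(J2) are the sibling file
# `…Prop7SymAvgTwSymDefs`.

Cell `ym3-torus` ∕ width seat `ym-ust-20520-w5` (gen 3).  YM₃ on T³ is ladder rung R3, not the Clay problem; nothing here is a claim about the stub, the crux or the gap.

THE PRINT.  [Balaban1985Averaging] p. 27 (58): `(R_{0,y}V₁)(Γ_{y,x}) = ∏_{b∈Γ_{y,x}} R(V₀(Γ_{y,b₋}))V₁(b)` (`= V(Γ_{y,x})·V₀(Γ_{y,x})⁻¹` for `V = V₁V₀`, telescoping); p. 30 (82):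
«\overline{R_{0,y}V₁} = exp[Σ_x L^{−d} log (R_{0,y}V₁)(Γ_{y,x})]»; p. 31 (89): «(\overline{\overline{R(V₀)V₁}})_c = (\overline{R_{0,c₋}V₁})⁻¹(\overline{V₁V₀})_c(V̄₀)_c⁻¹R̄_{0,c}\overline{R_{0,c₊}V₁}»
— so the FULL next-level field is `V̿₁·V̄₀ = w(c₋)⁻¹·V̄(c)·w(c₊)`; p. 32 (97): accumulation of the frames over the levels; p. 36 (127) ∕ p. 40 (150): `Q_{j+1}(U₀, ηA) = Q(Ū₀ʲ, Q_j(U₀, ηA))`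
(frames recomputed at every level against the background tower `Ū₀ʲ`).  CONVENTIONS (★w8-19936 g0, bus 07:40:27Z∕07:49:32Z): the background enters ONLY through extra `holT U₀`
factors multiplying the SAME `Idx P` `eml` family of `vframeU` (never a changed index family or word), inverse frame LEFT at `c.src`, frame RIGHT at `c.tgt`, tower by the
RECOMPUTED recursion (`_succ` rfl) with the accumulated form (97) a theorem — so that at `U₀ = 1` everything specialises LITERALLY to ✓p610309 ((J1) generic, §1 end).

HONEST SCOPE.  Twisted transporter in CLOSED form `W(Γ)·U₀(Γ)⁻¹`, `W` the FULL field; frames are `𝔸ˣ`-valued `exp[mean log]`'s (`ExpMeanLog.eml`, no guard).  No estimate, no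
smallness, no summit statement; count-neutral toward stmt-QuantumFields-19200 (`--supports`); definitions (review lane) + unfoldings + (97) + values at the background and at `1`.

References: T. Bałaban, CMP **98** (1985) 17–51 [Balaban1985Averaging] ((8), (11) p.19, (58) p.27, (82) p.30, (87)–(92) p.31, (97) p.32, (110) p.34, (127) p.36, (150) p.40);
CMP **109** (1987) 249–301 [Balaban1987RG1] ((0.4), (0.11) p.253).
-/

noncomputable section

namespace Summit.QuantumFields.YangMills.Theorems.Prop7SymAvgTwSym

open NormedSpace
open Literature.MathematicalPhysics.QuantumFieldTheory.Balaban1983to89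
open T4Continuum BlockAveraging ExpMeanLog MatrixLog
open B10Eq27TorusAxialLog (holT holT_nil holT_one gaugeActT gaugeActT_apply)
open Summit.QuantumFields.YangMills.Theorems.Prop8Chart (emlAvgU emlIterU emlIterU_succ emlIterU_zero emlIterU_one emlAvgU_gaugeActT eml_const_one)
open Summit.QuantumFields.YangMills.Theorems.Prop8ChartDoubleBar (vframeU coe_vframeU dbarAvgU dbarAvgU_eq_gaugeActT dbarIterU dbarIterU_succ dbarIterU_zero)

/-! ## §1 Generic level-`j` objects: twisted stair transporters, the symmetric covariant frame, the covariant double bar, its tower, the accumulated frames -/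

section Generic

variable {P : Params} {𝔸 : Type*} [NormedRing 𝔸] [NormedAlgebra ℂ 𝔸] [CompleteSpace 𝔸]

section OneLevel

variable {j : ℕ}

/-- **THE TWISTED CENTRE-STAIR TRANSPORTER** of the perturbation `W₁ = W·U₀⁻¹` (`W` the FULL field, `U₀` the background) along the stair `Γ_{y,x_i}` of index `i : Idx P` from the
block centre `emb y`: `(R_{0,y}W₁)(Γ) = ∏_{b∈Γ} R(U₀(Γ_{y,b₋}))W₁(b) = W(Γ)·U₀(Γ)⁻¹` ((58), telescoped).  The SAME stair words `stairWord i.2.1 (off i.1)` as `vframeU` and as the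
legs of the (0.4) loops of `emlAvgU`. [cite: Balaban1985Averaging, (58) p.27, (82) p.30] -/
def tstairU (U₀ W : GaugeField P j 𝔸ˣ) (y : Site P (j + 1)) (i : Idx P) : 𝔸ˣ :=
  holT W (emb y) (stairWord i.2.1 (off i.1)) * (holT U₀ (emb y) (stairWord i.2.1 (off i.1)))⁻¹

omit [NormedAlgebra ℂ 𝔸] [CompleteSpace 𝔸] in
/-- `tstairU` unfolded. [cite: Balaban1985Averaging, (58) p.27] -/
theorem tstairU_def (U₀ W : GaugeField P j 𝔸ˣ) (y : Site P (j + 1)) (i : Idx P) :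
    tstairU U₀ W y i = holT W (emb y) (stairWord i.2.1 (off i.1)) * (holT U₀ (emb y) (stairWord i.2.1 (off i.1)))⁻¹ := rfl

/-- **THE SYMMETRIC COVARIANT BLOCK FRAME `w_sym(y) = \overline{R_{0,y}W₁}` (ONE LEVEL)**: the `exp[mean log]` over the symmetrised index family `Idx P` (offsets × stair orders) of
the twisted centre-stair transporters — print's (82) with the route's centred staircases; the `U₀ ≠ 1` twin of ✓`Prop8ChartDoubleBar.vframeU`. [cite: Balaban1985Averaging, (82) p.30, (110) p.34] -/
def vframeCovU (U₀ W : GaugeField P j 𝔸ˣ) (y : Site P (j + 1)) : 𝔸ˣ :=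
  (isUnit_eml (fun i : Idx P => ((tstairU U₀ W y i : 𝔸ˣ) : 𝔸))).unit

/-- the value of the covariant frame. [cite: Balaban1985Averaging, (82) p.30] -/
theorem coe_vframeCovU (U₀ W : GaugeField P j 𝔸ˣ) (y : Site P (j + 1)) :
    ((vframeCovU U₀ W y : 𝔸ˣ) : 𝔸) = eml (fun i : Idx P => ((tstairU U₀ W y i : 𝔸ˣ) : 𝔸)) := by
  rw [vframeCovU, IsUnit.unit_spec]

/-- **THE COVARIANT DOUBLE BAR (89), AS THE FULL NEXT-LEVEL FIELD**: `(V̿₁·V̄₀)(c) = w(c₋)⁻¹·V̄(c)·w(c₊)` — the single-bar (0.4) average of the full field gauge-transformed at the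
coarse sites by the inverse covariant frames (print's `(\overline{R_{0,c₋}V₁})⁻¹(\overline{V₁V₀})_c(V̄₀)_c⁻¹R̄_{0,c}\overline{R_{0,c₊}V₁}` times `V̄₀(c)`); the `U₀ ≠ 1` twin of
`dbarAvgU = (emlAvgU ·)^{v⁻¹}`. [cite: Balaban1985Averaging, (89) p.31, (11) p.19] -/
def dbarCovU (U₀ W : GaugeField P j 𝔸ˣ) : GaugeField P (j + 1) 𝔸ˣ :=
  gaugeActT (fun y : Site P (j + 1) => (vframeCovU U₀ W y)⁻¹) (emlAvgU W)

/-- (89) unfolded. [cite: Balaban1985Averaging, (89) p.31] -/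
theorem dbarCovU_def (U₀ W : GaugeField P j 𝔸ˣ) :
    dbarCovU U₀ W = gaugeActT (fun y : Site P (j + 1) => (vframeCovU U₀ W y)⁻¹) (emlAvgU W) := rfl

/-- (89) at a coarse bond: `w(c₋)⁻¹·W̄(c)·w(c₊)`. [cite: Balaban1985Averaging, (89) p.31] -/
theorem dbarCovU_apply (U₀ W : GaugeField P j 𝔸ˣ) (c : PBond P (j + 1)) :
    dbarCovU U₀ W c = (vframeCovU U₀ W c.src)⁻¹ * emlAvgU W c * vframeCovU U₀ W c.tgt := by
  rw [dbarCovU_def, gaugeActT_apply, inv_inv]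

omit [NormedAlgebra ℂ 𝔸] [CompleteSpace 𝔸] in
/-- At the background itself every twisted transporter is trivial: `U₀(Γ)·U₀(Γ)⁻¹ = 1`. [cite: Balaban1985Averaging, (58) p.27] -/
@[simp] theorem tstairU_self (U₀ : GaugeField P j 𝔸ˣ) (y : Site P (j + 1)) (i : Idx P) : tstairU U₀ U₀ y i = 1 := by
  rw [tstairU_def, mul_inv_cancel]

/-- At the background itself the covariant frame is trivial: `w_sym(U₀; U₀) = 1`. [cite: Balaban1985Averaging, (82) p.30] -/
@[simp] theorem vframeCovU_self (U₀ : GaugeField P j 𝔸ˣ) (y : Site P (j + 1)) : vframeCovU U₀ U₀ y = 1 := by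
  apply Units.ext
  rw [coe_vframeCovU, Units.val_one]
  have h1 : (fun i : Idx P => ((tstairU U₀ U₀ y i : 𝔸ˣ) : 𝔸)) = fun _ => 1 := by
    funext i; rw [tstairU_self, Units.val_one]
  rw [h1, eml_const_one]

/-- At the background itself the covariant double bar is the single bar: `dbarCovU U₀ U₀ = Ū₀`. [cite: Balaban1985Averaging, (89) p.31] -/
@[simp] theorem dbarCovU_self (U₀ : GaugeField P j 𝔸ˣ) : dbarCovU U₀ U₀ = emlAvgU U₀ := by
  funext c
  rw [dbarCovU_apply, vframeCovU_self, vframeCovU_self, inv_one, one_mul, mul_one]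

omit [NormedAlgebra ℂ 𝔸] [CompleteSpace 𝔸] in
/-- **(J1) TRANSPORTERS**: at background `1` the twisted transporter is the plain centre-stair transporter of `vframeU`. [cite: Balaban1985Averaging, (58) p.27, (110) p.34] -/
theorem tstairU_one (W : GaugeField P j 𝔸ˣ) (y : Site P (j + 1)) (i : Idx P) :
    tstairU (fun _ : PBond P j => (1 : 𝔸ˣ)) W y i = holT W (emb y) (stairWord i.2.1 (off i.1)) := by
  rw [tstairU_def, holT_one, inv_one, mul_one]

/-- ★ **(J1) FRAMES: `w_sym` AT BACKGROUND `1` IS ✓`Prop8ChartDoubleBar.vframeU`** — literally. [cite: Balaban1985Averaging, (82) p.30, (110) p.34] -/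
theorem vframeCovU_one (W : GaugeField P j 𝔸ˣ) (y : Site P (j + 1)) : vframeCovU (fun _ : PBond P j => (1 : 𝔸ˣ)) W y = vframeU W y := by
  apply Units.ext
  rw [coe_vframeCovU, coe_vframeU]
  have h1 : (fun i : Idx P => ((tstairU (fun _ : PBond P j => (1 : 𝔸ˣ)) W y i : 𝔸ˣ) : 𝔸)) =
      fun i : Idx P => ((holT W (emb y) (stairWord i.2.1 (off i.1)) : 𝔸ˣ) : 𝔸) := by
    funext i; rw [tstairU_one]
  rw [h1]

/-- ★ **(J1) ONE STEP: THE COVARIANT DOUBLE BAR AT BACKGROUND `1` IS ✓`Prop8ChartDoubleBar.dbarAvgU`** — literally. [cite: Balaban1985Averaging, (89) p.31] -/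
theorem dbarCovU_one (W : GaugeField P j 𝔸ˣ) : dbarCovU (fun _ : PBond P j => (1 : 𝔸ˣ)) W = dbarAvgU W := by
  rw [dbarCovU_def, dbarAvgU_eq_gaugeActT]
  congr 1
  funext y
  rw [vframeCovU_one]

end OneLevel

/-- **THE COVARIANT DOUBLE-BAR TOWER `(U̿₁·Ū₀)^{(k)}`** — frames recomputed at every level against the background tower `Ū₀ʲ = emlIterU j U₀` ((127)∕(150):
`Q_{j+1}(U₀, ηA) = Q(Ū₀ʲ, Q_j(U₀, ηA))`); the `U₀ ≠ 1` twin of ✓`Prop8ChartDoubleBar.dbarIterU`. [cite: Balaban1985Averaging, (127) p.36, (150) p.40] -/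
def dbarCovIterU : (k : ℕ) → GaugeField P 0 𝔸ˣ → GaugeField P 0 𝔸ˣ → GaugeField P k 𝔸ˣ
  | 0 => fun _ W => W
  | k + 1 => fun U₀ W => dbarCovU (emlIterU k U₀) (dbarCovIterU k U₀ W)

/-- no averaging. [cite: Balaban1985Averaging, (127) p.36] -/
@[simp] theorem dbarCovIterU_zero (U₀ W : GaugeField P 0 𝔸ˣ) : dbarCovIterU 0 U₀ W = W := rfl

/-- one more level, frames against `Ū₀ᵏ = emlIterU k U₀`. [cite: Balaban1985Averaging, (127) p.36, (150) p.40] -/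
theorem dbarCovIterU_succ (k : ℕ) (U₀ W : GaugeField P 0 𝔸ˣ) : dbarCovIterU (k + 1) U₀ W = dbarCovU (emlIterU k U₀) (dbarCovIterU k U₀ W) := rfl

/-- **THE ACCUMULATED SYMMETRIC COVARIANT FRAMES `w_sym^{(k)}`** ((97): `v_{j+1}(y) = v_j(emb y)·w_j(y)`, `w_j` the one-level covariant frame of the level-`j` tower field against
`Ū₀ʲ`) — the gauge transformation carrying the plain `k`-fold average `Ū^{(k)}` of the full field to the covariant double-bar tower (`dbarCovIterU_eq_gaugeActT_frameAccU`).
[cite: Balaban1985Averaging, (97) p.32, (87) p.31] -/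
def frameAccU : (k : ℕ) → GaugeField P 0 𝔸ˣ → GaugeField P 0 𝔸ˣ → Site P k → 𝔸ˣ
  | 0 => fun _ _ _ => 1
  | k + 1 => fun U₀ W y => frameAccU k U₀ W (emb y) * vframeCovU (emlIterU k U₀) (dbarCovIterU k U₀ W) y

/-- no frame at level `0`. [cite: Balaban1985Averaging, (97) p.32] -/
@[simp] theorem frameAccU_zero (U₀ W : GaugeField P 0 𝔸ˣ) (x : Site P 0) : frameAccU 0 U₀ W x = 1 := rfl

/-- (97): `v_{k+1}(y) = v_k(emb y)·w_k(y)`. [cite: Balaban1985Averaging, (97) p.32] -/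
theorem frameAccU_succ (k : ℕ) (U₀ W : GaugeField P 0 𝔸ˣ) (y : Site P (k + 1)) :
    frameAccU (k + 1) U₀ W y = frameAccU k U₀ W (emb y) * vframeCovU (emlIterU k U₀) (dbarCovIterU k U₀ W) y := rfl

omit [NormedAlgebra ℂ 𝔸] [CompleteSpace 𝔸] in
/-- composition of coarse gauge transformations (group algebra; local copy — the `Prop8ChartDoubleBar` edition is ★w8-19936's). [cite: Balaban1985Averaging, (8) p.19] -/
private theorem gaugeActT_gaugeActT {k : ℕ} (u v : Site P k → 𝔸ˣ) (V : GaugeField P k 𝔸ˣ) :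
    gaugeActT u (gaugeActT v V) = gaugeActT (fun x => u x * v x) V := by
  funext b
  simp only [gaugeActT_apply, mul_inv_rev, mul_assoc]

omit [NormedAlgebra ℂ 𝔸] [CompleteSpace 𝔸] in
/-- the trivial gauge transformation acts trivially (local copy). [cite: Balaban1985Averaging, (8) p.19] -/
private theorem gaugeActT_one_fun {k : ℕ} (V : GaugeField P k 𝔸ˣ) : gaugeActT (fun _ : Site P k => (1 : 𝔸ˣ)) V = V := by
  funext b
  rw [gaugeActT_apply, inv_one, one_mul, mul_one]

/-- ★ **(97) — THE TOWER IS THE PLAIN AVERAGE IN THE ACCUMULATED FRAMES**: `(U̿₁·Ū₀)^{(k)} = (Ū^{(k)})^{(v_k)⁻¹}` with `Ū^{(k)} = emlIterU k W` the plain `k`-fold (0.4) average of the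
full field — by the covariance `emlAvgU (V^u) = (emlAvgU V)^{u∘emb}` (✓`Prop8Chart.emlAvgU_gaugeActT`) level by level. [cite: Balaban1985Averaging, (97) p.32, (11) p.19, (89) p.31] -/
theorem dbarCovIterU_eq_gaugeActT_frameAccU (U₀ W : GaugeField P 0 𝔸ˣ) :
    ∀ k : ℕ, dbarCovIterU k U₀ W = gaugeActT (fun y : Site P k => (frameAccU k U₀ W y)⁻¹) (emlIterU k W)
  | 0 => by
    rw [dbarCovIterU_zero, emlIterU_zero]
    have h1 : (fun y : Site P 0 => (frameAccU 0 U₀ W y)⁻¹) = fun _ => 1 := by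
      funext y; rw [frameAccU_zero, inv_one]
    rw [h1, gaugeActT_one_fun]
  | k + 1 => by
    have hk := dbarCovIterU_eq_gaugeActT_frameAccU U₀ W k
    rw [dbarCovIterU_succ, dbarCovU_def]
    conv_lhs => rw [hk, emlAvgU_gaugeActT, ← hk]
    rw [gaugeActT_gaugeActT, ← emlIterU_succ]
    rfl

/-- At the background itself the tower is the plain background tower: `dbarCovIterU k U₀ U₀ = Ū₀^{(k)}`. [cite: Balaban1985Averaging, (127) p.36] -/
@[simp] theorem dbarCovIterU_self (U₀ : GaugeField P 0 𝔸ˣ) : ∀ k : ℕ, dbarCovIterU k U₀ U₀ = emlIterU k U₀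
  | 0 => rfl
  | k + 1 => by rw [dbarCovIterU_succ, dbarCovIterU_self U₀ k, dbarCovU_self, emlIterU_succ]

/-- At the background itself the accumulated frames are trivial. [cite: Balaban1985Averaging, (97) p.32] -/
@[simp] theorem frameAccU_self (U₀ : GaugeField P 0 𝔸ˣ) : ∀ (k : ℕ) (y : Site P k), frameAccU k U₀ U₀ y = 1
  | 0, _ => rfl
  | k + 1, y => by rw [frameAccU_succ, frameAccU_self U₀ k, dbarCovIterU_self, vframeCovU_self, one_mul]

/-- ★ **(J1) THE TOWER: AT BACKGROUND `1` THE COVARIANT TOWER IS ✓`Prop8ChartDoubleBar.dbarIterU`** — literally (`Ū₀ʲ = 1` at every level, `emlIterU_one`; one step = `dbarCovU_one`).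
[cite: Balaban1985Averaging, (127) p.36, (150) p.40] -/
theorem dbarCovIterU_one (W : GaugeField P 0 𝔸ˣ) : ∀ k : ℕ, dbarCovIterU k (fun _ : PBond P 0 => (1 : 𝔸ˣ)) W = dbarIterU k W
  | 0 => rfl
  | k + 1 => by rw [dbarCovIterU_succ, dbarCovIterU_one W k, emlIterU_one, dbarCovU_one, dbarIterU_succ]

/-- ★ **(J1) ACCUMULATED FRAMES AT BACKGROUND `1`**: `v_{k+1}(y) = v_k(emb y)·vframeU(U̿^{(k)}W)(y)` — the displayed recursion `hVs` of the H side's accumulated-frame form of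
`dbarIterU` ((97) at `U₀ = 1`), met literally by `V j := frameAccU j 1 W` (`hV0 := frameAccU_zero`). [cite: Balaban1985Averaging, (97) p.32, (110) p.34] -/
theorem frameAccU_one_succ (W : GaugeField P 0 𝔸ˣ) (k : ℕ) (y : Site P (k + 1)) :
    frameAccU (k + 1) (fun _ : PBond P 0 => (1 : 𝔸ˣ)) W y = frameAccU k (fun _ : PBond P 0 => (1 : 𝔸ˣ)) W (emb y) * vframeU (dbarIterU k W) y := by
  rw [frameAccU_succ, emlIterU_one, dbarCovIterU_one, vframeCovU_one]

/-- (97) at background `1`: `U̿^{(k)}(W) = (Ū^{(k)}W)^{(v_k)⁻¹}` with the accumulated frames `frameAccU k 1 W` — the H side's iterate in accumulated-frame form.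
[cite: Balaban1985Averaging, (97) p.32, (127) p.36] -/
theorem dbarIterU_eq_gaugeActT_frameAccU_one (W : GaugeField P 0 𝔸ˣ) (k : ℕ) :
    dbarIterU k W = gaugeActT (fun y : Site P k => (frameAccU k (fun _ : PBond P 0 => (1 : 𝔸ˣ)) W y)⁻¹) (emlIterU k W) := by
  rw [← dbarCovIterU_one, dbarCovIterU_eq_gaugeActT_frameAccU]

end Generic

end Summit.QuantumFields.YangMills.Theorems.Prop7SymAvgTwSym

end
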